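/-
PORT (pub-hodgecm2, COR-CM cell) of the stage-1 package file `HodgeCMPerL/HodgeCM/Proofs/Prop22/Eigen.lean`
(pub-hodgecm HOME/lean, bytes of record md5 0a9c1df77fe8, 352 lines). Declarations VERBATIM; edits: imports rewritten to tree
modules, namespace token `HodgeCM` ↦ `Summit.HodgeConjecture.CorCM`, package `conjRingHomK` ↦ tree `Literature.NumberTheory.Automorphic.cmConjRingHom`
(definitionally equal bodies), linter fixes. Generator: pub-hodgecm2-p1 `work/port/build_kit.py`.
-/
/-
Copyright: pub-hodgecm formalisation cell (harness21, 2026). New file (not vendored).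
-/
import Summits.HodgeConjecture.CorCM.Proofs.Prop22.Dictionary
import Summits.HodgeConjecture.CorCM.Proofs.Prop22.Multilinear

/-!
# rfwf Prop 2.2, Step F (i): eigen-bookkeeping on `H⁴(P, ℂ)`

`P = ∏ᵢ A_{Φᵢ}`. We record: a SEPARATING integer `b ∈ 𝓞_K` (the character `τ₁τ₂τ₃τ₄` of a four-fold
cup of eigenclasses takes the value `σ(b)⁴` only on the Weil character `σ⁴`); the diagonal action of
`𝓞_K` on `P` (from M18, M24); eigenbases of `H¹(A_{Φᵢ}, ℂ)` (M11, M22); the spanning of `H¹(P, ℂ)` by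
pulled-back eigenclasses (M21) and of `H⁴(P, ℂ)` by their four-fold cups (M23); and the fact that the
`σ⁴`-part of the latter is the line through the Weil generator (alternation, M19–M20).
-/

noncomputable section

open scoped TensorProduct NumberField

namespace Summit.HodgeConjecture.CorCM

open Literature.AlgebraicGeometry.Motives
open Literature.AlgebraicGeometry.Motives.HodgeStructure (EndAction conj ofRat conj_baseChange conj_smul
  conj_conj conj_tmul)
open Literature.NumberTheory.Automorphic (cmConjRingHom embedding_cmConjRingHom)
open NumberField (RingOfIntegers)
open Polynomial

/-! ### S5. A separating integer -/

/-- an algebraic integer `β` on which the complex embeddings take pairwise distinct values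
(an integral multiple of a primitive element) -/
theorem exists_integral_injective_eval (K : CMField) :
    ∃ β : K, IsIntegral ℤ β ∧ Function.Injective fun τ : K →+* ℂ => τ β := by
  obtain ⟨θ, hθ⟩ := Field.exists_primitive_element ℚ K
  have hθinj : Function.Injective fun φ : K →ₐ[ℚ] ℂ => φ θ :=
    (Field.primitive_element_iff_algHom_eq_of_eval' ℚ ℂ (fun x => IsAlgClosed.splits _) θ).mp hθ
  obtain ⟨d, hd⟩ := IsIntegral.exists_multiple_integral_of_isLocalization (nonZeroDivisors ℤ) θ
    (Algebra.IsIntegral.isIntegral (R := ℚ) θ)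
  refine ⟨(d : ℤ) • θ, hd, ?_⟩
  intro τ τ' h
  simp only [map_zsmul] at h
  have hd0 : (d : ℤ) ≠ 0 := nonZeroDivisors.coe_ne_zero d
  have h' : τ θ = τ' θ := smul_right_injective ℂ hd0 h
  have h2 : τ.toRatAlgHom = τ'.toRatAlgHom := hθinj (a₁ := τ.toRatAlgHom) (a₂ := τ'.toRatAlgHom) h'
  have h3 := congrArg (fun φ : K →ₐ[ℚ] ℂ => (φ : K →+* ℂ)) h2
  simpa only [RingHom.toRatAlgHom_toRingHom] using h3

/-- **Separating element.** There is a nonzero algebraic integer `b ∈ 𝓞_K` such that a product of four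
values `τⱼ(b)` of complex embeddings equals `σ(b)⁴` only if all `τⱼ = σ`. (Take `b = q + β` with `β` an
integral element separating the embeddings and `q ∈ ℤ` outside a finite exceptional set: the identity
`∏ⱼ (X + τⱼ(β)) = (X + σ(β))⁴` of polynomials forces `τⱼ(β) = σ(β)` by comparing roots.) -/
theorem exists_separating (K : CMField) : ∃ b : 𝓞 K, (b : K) ≠ 0 ∧
    ∀ (τ : Fin 4 → (K →+* ℂ)) (σ : K →+* ℂ), (∏ j, τ j (b : K)) = (σ (b : K)) ^ 4 → ∀ j, τ j = σ := by
  classical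
  obtain ⟨β, hβint, hβinj⟩ := exists_integral_injective_eval K
  -- the exceptional polynomial attached to `(τ, σ)`
  let P : (Fin 4 → (K →+* ℂ)) × (K →+* ℂ) → ℂ[X] := fun p =>
    (∏ j, (X - C (-(p.1 j β)))) - (X - C (-(p.2 β))) ^ 4
  have hPeval : ∀ p (q : ℤ), (P p).eval (q : ℂ) = (∏ j, p.1 j ((q : K) + β)) - (p.2 ((q : K) + β)) ^ 4 := by
    intro p q
    simp only [P, eval_sub, eval_prod, eval_pow, eval_X, eval_C, sub_neg_eq_add, map_add, map_intCast]
  have hPzero : ∀ p, P p = 0 → ∀ j, p.1 j = p.2 := by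
    intro p hP j
    have hA0 : (∏ j, (X - C (-(p.1 j β)))) ≠ 0 :=
      (monic_prod_of_monic _ _ fun j _ => monic_X_sub_C _).ne_zero
    have hAB : (∏ j, (X - C (-(p.1 j β)))) = (X - C (-(p.2 β))) ^ 4 := sub_eq_zero.mp hP
    have hmem : -(p.1 j β) ∈ (∏ j, (X - C (-(p.1 j β)))).roots := by
      rw [roots_prod _ _ hA0, Multiset.mem_bind]
      exact ⟨j, Finset.mem_val.mpr (Finset.mem_univ _), by rw [roots_X_sub_C]; exact Multiset.mem_singleton_self _⟩
    rw [hAB, roots_pow, roots_X_sub_C, Multiset.mem_nsmul] at hmem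
    have h2 := Multiset.mem_singleton.mp hmem.2
    exact hβinj (neg_injective h2)
  -- the finite exceptional set of integers
  let Bad : Set ℤ := (⋃ p, {q : ℤ | P p ≠ 0 ∧ (P p).IsRoot (q : ℂ)}) ∪ {q | (q : K) + β = 0}
  have hBad : Bad.Finite := by
    refine Set.Finite.union (Set.finite_iUnion fun p => ?_) ?_
    · by_cases hp : P p = 0
      · simp [hp]
      · have : {q : ℤ | P p ≠ 0 ∧ (P p).IsRoot (q : ℂ)} = ((↑) : ℤ → ℂ) ⁻¹' {x | (P p).IsRoot x} := by
          ext q; simp [hp]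
        rw [this]
        exact Set.Finite.preimage Int.cast_injective.injOn (finite_setOf_isRoot hp)
    · apply Set.Subsingleton.finite
      intro q hq q' hq'
      simp only [Set.mem_setOf_eq] at hq hq'
      have : (q : K) = q' := by rw [eq_neg_of_add_eq_zero_left hq, eq_neg_of_add_eq_zero_left hq']
      exact_mod_cast this
  obtain ⟨q, hq⟩ := Infinite.exists_notMem_finset hBad.toFinset
  rw [Set.Finite.mem_toFinset] at hq
  -- the separating integer `b = q + β`
  have hqint : IsIntegral ℤ (q : K) := by
    simpa only [eq_intCast] using (isIntegral_algebraMap (R := ℤ) (A := K) (x := q))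
  refine ⟨⟨(q : K) + β, hqint.add hβint⟩, ?_, ?_⟩
  · show (q : K) + β ≠ 0
    exact fun h0 => hq (Or.inr h0)
  · intro τs σ hprod j
    have hev : (P (τs, σ)).eval (q : ℂ) = 0 := by
      rw [hPeval]; exact sub_eq_zero.mpr hprod
    by_cases hP : P (τs, σ) = 0
    · exact hPzero _ hP j
    · have hmem : q ∈ ⋃ p, {q : ℤ | P p ≠ 0 ∧ (P p).IsRoot (q : ℂ)} := Set.mem_iUnion.mpr ⟨(τs, σ), hP, hev⟩
      exact absurd (Or.inl hmem) hq

/-- A separating integer `b` (the product condition of rfwf Prop 2.2) separates the complex embeddings: `τ ↦ τ b` is injective. -/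
theorem injective_eval_of_separating {K : CMField} {b : 𝓞 K}
    (hb : ∀ (τ : Fin 4 → (K →+* ℂ)) (σ : K →+* ℂ), (∏ j, τ j (b : K)) = (σ (b : K)) ^ 4 → ∀ j, τ j = σ) :
    Function.Injective fun τ : K →+* ℂ => τ (b : K) := by
  intro τ σ h
  have := hb (fun _ => τ) σ (by simp [h, Finset.prod_const]) 0
  exact this

namespace Universe

variable {U : Universe}

/-! ### S6. The diagonal action of `𝓞_K` on the corner product -/

/-- Every `a ∈ 𝓞_K` acts diagonally on the corner product `P = ∏ A_{Φᵢ}` by a morphism (from `Fact_cmEnd` and `Fact_lift`). -/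
theorem exists_diagAct (M : U.ModelAxioms) (K : CMField) (Φ : Fin 4 → CMType K) (a : 𝓞 K) :
    ∃ Ma : U.Mor (U.prod4 K Φ) (U.prod4 K Φ), U.IsDiagAct K Φ (a : K) Ma := by
  have he := fun i => M.cmEnd K (Φ i) a
  choose e he using he
  obtain ⟨h01, h01f, h01s⟩ := M.lift _ _ _ (U.comp (U.pr4 K Φ 0) (e 0)) (U.comp (U.pr4 K Φ 1) (e 1))
  obtain ⟨h012, h012f, h012s⟩ := M.lift _ _ _ h01 (U.comp (U.pr4 K Φ 2) (e 2))
  obtain ⟨Ma, hMaf, hMas⟩ : ∃ h : U.Mor (U.prod4 K Φ) (U.prod4 K Φ), U.comp h (U.fst _ _) = h012 ∧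
      U.comp h (U.snd _ _) = U.comp (U.pr4 K Φ 3) (e 3) := M.lift _ _ _ h012 _
  refine ⟨Ma, e, he, fun i k => ?_⟩
  -- pointwise consequences of the `lift` equations (`comp f g = g ∘ f`, `pull (comp f g) = pull f ∘ pull g`)
  have c1 : ∀ y, U.pull Ma k (U.pull (U.fst _ _) k y) = U.pull h012 k y := fun y => by
    show (U.pull Ma k ∘ₗ U.pull (U.fst _ _) k) y = _; rw [← M.pull_comp, hMaf]
  have c1' : ∀ y, U.pull Ma k (U.pull (U.snd _ _) k y) = U.pull (U.pr4 K Φ 3) k (U.pull (e 3) k y) :=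
    fun y => by
    show (U.pull Ma k ∘ₗ U.pull (U.snd _ _) k) y = _
    rw [← M.pull_comp, hMas, M.pull_comp, LinearMap.comp_apply]
  have c2 : ∀ y, U.pull h012 k (U.pull (U.fst _ _) k y) = U.pull h01 k y := fun y => by
    show (U.pull h012 k ∘ₗ U.pull (U.fst _ _) k) y = _; rw [← M.pull_comp, h012f]
  have c2' : ∀ y, U.pull h012 k (U.pull (U.snd _ _) k y) = U.pull (U.pr4 K Φ 2) k (U.pull (e 2) k y) :=
    fun y => by
    show (U.pull h012 k ∘ₗ U.pull (U.snd _ _) k) y = _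
    rw [← M.pull_comp, h012s, M.pull_comp, LinearMap.comp_apply]
  have c3 : ∀ y, U.pull h01 k (U.pull (U.fst _ _) k y) = U.pull (U.pr4 K Φ 0) k (U.pull (e 0) k y) :=
    fun y => by
    show (U.pull h01 k ∘ₗ U.pull (U.fst _ _) k) y = _
    rw [← M.pull_comp, h01f, M.pull_comp, LinearMap.comp_apply]
  have c3' : ∀ y, U.pull h01 k (U.pull (U.snd _ _) k y) = U.pull (U.pr4 K Φ 1) k (U.pull (e 1) k y) :=
    fun y => by
    show (U.pull h01 k ∘ₗ U.pull (U.snd _ _) k) y = _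
    rw [← M.pull_comp, h01s, M.pull_comp, LinearMap.comp_apply]
  have p0 : ∀ y, U.pull (U.pr4 K Φ 0) k y = U.pull (U.fst _ _) k (U.pull (U.fst _ _) k (U.pull (U.fst _ _) k y)) :=
    fun y => by
    show U.pull (U.comp (U.fst _ _) (U.comp (U.fst _ _) (U.fst _ _))) k y = _
    rw [M.pull_comp, M.pull_comp]; rfl
  have p1 : ∀ y, U.pull (U.pr4 K Φ 1) k y = U.pull (U.fst _ _) k (U.pull (U.fst _ _) k (U.pull (U.snd _ _) k y)) :=
    fun y => by
    show U.pull (U.comp (U.fst _ _) (U.comp (U.fst _ _) (U.snd _ _))) k y = _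
    rw [M.pull_comp, M.pull_comp]; rfl
  have p2 : ∀ y, U.pull (U.pr4 K Φ 2) k y = U.pull (U.fst _ _) k (U.pull (U.snd _ _) k y) :=
    fun y => by
    show U.pull (U.comp (U.fst _ _) (U.snd _ _)) k y = _
    rw [M.pull_comp]; rfl
  ext y
  simp only [LinearMap.comp_apply]
  match i with
  | 0 => rw [p0, c1, c2, c3]
  | 1 => rw [p1, c1, c2, c3']
  | 2 => rw [p2, c1, c2']
  | 3 => exact c1' y

/-- Pulling a Weil-type generator back along a diagonal action acts factorwise on the eigenclasses. -/
theorem pullC_weilGen_of_diagAct (M : U.ModelAxioms) {K : CMField} {Φ : Fin 4 → CMType K} {a : K}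
    {Ma : U.Mor (U.prod4 K Φ) (U.prod4 K Φ)} (h : U.IsDiagAct K Φ a Ma)
    (y : (i : Fin 4) → U.CohC (U.cmAV K (Φ i)) 1) :
    U.pullC Ma 4 (U.weilGen K Φ y) = U.weilGen K Φ (fun i => ((U.cmAct K (Φ i)).ι a).baseChange ℂ (y i)) := by
  obtain ⟨e, he, hcomm⟩ := h
  have key : ∀ i (v : U.CohC (U.cmAV K (Φ i)) 1), U.pullC Ma 1 (U.pullC (U.pr4 K Φ i) 1 v) =
      U.pullC (U.pr4 K Φ i) 1 (((U.cmAct K (Φ i)).ι a).baseChange ℂ v) := by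
    intro i v
    have h2 := congrArg (LinearMap.baseChange ℂ) (hcomm i 1)
    rw [LinearMap.baseChange_comp, LinearMap.baseChange_comp, he i] at h2
    exact LinearMap.congr_fun h2 v
  simp only [Universe.weilGen, pullC_quadC M.pull_cup, key]

/-- The Weil generator is multilinear: scaling the four eigenvectors scales it by the product of the scalars. -/
theorem weilGen_smul (K : CMField) (Φ : Fin 4 → CMType K) (y : (i : Fin 4) → U.CohC (U.cmAV K (Φ i)) 1)
    (c : Fin 4 → ℂ) : U.weilGen K Φ (fun i => c i • y i) = (∏ i, c i) • U.weilGen K Φ y := by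
  simp only [Universe.weilGen, Universe.quadC, map_smul, LinearMap.smul_apply, smul_smul,
    Fin.prod_univ_four]
  congr 1; ring

/-- A Weil generator of eigencharacter `σ` is an eigenvector of the diagonal action of `a` with eigenvalue
`σ(a)⁴`. -/
theorem pullC_weilGen_eigen (M : U.ModelAxioms) {K : CMField} {Φ : Fin 4 → CMType K} {a : K}
    {Ma : U.Mor (U.prod4 K Φ) (U.prod4 K Φ)} (h : U.IsDiagAct K Φ a Ma) {σ : K →+* ℂ}
    {y : (i : Fin 4) → U.CohC (U.cmAV K (Φ i)) 1} (hy : ∀ i, y i ∈ U.eigenLine K (Φ i) σ) :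
    U.pullC Ma 4 (U.weilGen K Φ y) = (σ a) ^ 4 • U.weilGen K Φ y := by
  rw [pullC_weilGen_of_diagAct M h]
  have : (fun i => ((U.cmAct K (Φ i)).ι a).baseChange ℂ (y i)) = fun i => (fun _ : Fin 4 => σ a) i • y i := by
    funext i; exact (mem_eigenLine_iff.mp (hy i)) a
  rw [this, weilGen_smul, Finset.prod_const, Finset.card_univ, Fintype.card_fin]

/-! ### S1. Eigenbases of `H¹(A_{(K,Φ)}, ℂ)` -/

/-- `H¹(A_{(K,Φ)}, ℂ)` has a basis of nonzero `τ`-eigenvectors, one for each complex embedding `τ` (`Fact_eigenLine`, `Fact_H1_rank`). -/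
theorem exists_eigenbasis (M : U.ModelAxioms) (K : CMField) (Φ : CMType K) (b : K)
    (hb : Function.Injective fun τ : K →+* ℂ => τ b) :
    ∃ x : (K →+* ℂ) → U.CohC (U.cmAV K Φ) 1,
      (∀ τ, x τ ∈ U.eigenLine K Φ τ) ∧ (∀ τ, x τ ≠ 0) ∧ Submodule.span ℂ (Set.range x) = ⊤ := by
  have hx : ∀ τ : K →+* ℂ, ∃ x ∈ U.eigenLine K Φ τ, x ≠ 0 := fun τ => by
    apply Submodule.exists_mem_ne_zero_of_ne_bot
    intro hbot
    have := M.eigenLine K Φ τ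
    rw [hbot, finrank_bot] at this
    exact zero_ne_one this
  choose x hx hx0 using hx
  refine ⟨x, hx, hx0, ?_⟩
  have hli : LinearIndependent ℂ x := by
    refine Module.End.eigenvectors_linearIndependent' (((U.cmAct K Φ).ι b).baseChange ℂ) (fun τ => τ b) hb x
      fun τ => ⟨?_, hx0 τ⟩
    exact Module.End.mem_eigenspace_iff.mpr ((mem_eigenLine_iff.mp (hx τ)) b)
  refine hli.span_eq_top_of_card_eq_finrank' ?_
  rw [NumberField.Embeddings.card]
  exact (Module.finrank_baseChange.trans (M.H1_rank K Φ)).symm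

/-! ### S2. `H¹(P, ℂ)` is spanned by pulled-back eigenclasses -/

section prod4

variable (K : CMField) (Φ : Fin 4 → CMType K)

/-- The label set of the eigenbasis of `H¹(P, ℂ)`: (factor, embedding). -/
abbrev Lab := Fin 4 × (K →+* ℂ)

variable {K Φ}

/-- `u_{(i,τ)} = prᵢ^* x_{i,τ}`. -/
def uvec (x : (i : Fin 4) → (K →+* ℂ) → U.CohC (U.cmAV K (Φ i)) 1) (p : Lab K) : U.CohC (U.prod4 K Φ) 1 :=
  U.pullC (U.pr4 K Φ p.1) 1 (x p.1 p.2)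

/-- the four-fold cups `Q_p` of the `u`'s -/
def quadU (x : (i : Fin 4) → (K →+* ℂ) → U.CohC (U.cmAV K (Φ i)) 1) (p : Fin 4 → Lab K) :
    U.CohC (U.prod4 K Φ) 4 :=
  U.quadC _ (U.uvec x (p 0)) (U.uvec x (p 1)) (U.uvec x (p 2)) (U.uvec x (p 3))

/-- every rational degree-one class on `P` is a sum of pulled-back classes from the four factors (M21) -/
theorem exists_eq_sum_pull_pr4 (M : U.ModelAxioms) (w : U.Coh (U.prod4 K Φ) 1) :
    ∃ v : (i : Fin 4) → U.Coh (U.cmAV K (Φ i)) 1, w = ∑ i, U.pull (U.pr4 K Φ i) 1 (v i) := by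
  obtain ⟨⟨w3, v3⟩, h3⟩ := (M.kunneth1 _ _).2 w
  obtain ⟨⟨w2, v2⟩, h2⟩ := (M.kunneth1 _ _).2 w3
  obtain ⟨⟨v0, v1⟩, h1⟩ := (M.kunneth1 _ _).2 w2
  simp only [LinearMap.coprod_apply] at h1 h2 h3
  refine ⟨fun i => match i with | 0 => v0 | 1 => v1 | 2 => v2 | 3 => v3, ?_⟩
  rw [Fin.sum_univ_four]
  simp only
  rw [pull_pr4_zero 1 M, pull_pr4_one 1 M, pull_pr4_two 1 M, pull_pr4_three, ← h3, ← h2, ← h1]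
  simp only [map_add]

/-- The pulled-back eigenvectors `uvec x (i, τ)` span `H¹(P, ℂ)` (Künneth in degree one, `Fact_kunneth1`). -/
theorem span_uvec_eq_top (M : U.ModelAxioms) (x : (i : Fin 4) → (K →+* ℂ) → U.CohC (U.cmAV K (Φ i)) 1)
    (hsp : ∀ i, Submodule.span ℂ (Set.range (x i)) = ⊤) :
    Submodule.span ℂ (Set.range (U.uvec x)) = ⊤ := by
  have hi : ∀ i (t : U.CohC (U.cmAV K (Φ i)) 1), U.pullC (U.pr4 K Φ i) 1 t ∈ Submodule.span ℂ (Set.range (U.uvec x)) := by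
    intro i t
    have ht : t ∈ Submodule.span ℂ (Set.range (x i)) := by rw [hsp i]; trivial
    induction ht using Submodule.span_induction with
    | mem t ht => obtain ⟨τ, rfl⟩ := ht; exact Submodule.subset_span (Set.mem_range.mpr ⟨(i, τ), rfl⟩)
    | zero => simp
    | add t t' _ _ h h' => simpa only [map_add] using add_mem h h'
    | smul r t _ h => simpa only [map_smul] using Submodule.smul_mem _ r h
  rw [eq_top_iff]
  rintro t -
  induction t using TensorProduct.induction_on with
  | zero => exact zero_mem _
  | add t t' h h' => exact add_mem h h'
  | tmul c w =>
    have : c ⊗ₜ[ℚ] w = c • ((1 : ℂ) ⊗ₜ[ℚ] w) := by rw [TensorProduct.smul_tmul', smul_eq_mul, mul_one]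
    rw [this]
    refine Submodule.smul_mem _ c ?_
    obtain ⟨v, rfl⟩ := U.exists_eq_sum_pull_pr4 M w
    rw [TensorProduct.tmul_sum]
    refine Submodule.sum_mem _ fun i _ => ?_
    rw [← pullC_tmul]
    exact hi i _

/-! ### S3. `H⁴(P, ℂ)` is spanned by the four-fold cups of the `u`'s -/

/-- The four-fold cups `quadU x` of pulled-back eigenvectors span `H⁴(P, ℂ)` (`Fact_H4_span`). -/
theorem span_quadU_eq_top (M : U.ModelAxioms) (x : (i : Fin 4) → (K →+* ℂ) → U.CohC (U.cmAV K (Φ i)) 1)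
    (hsp : ∀ i, Submodule.span ℂ (Set.range (x i)) = ⊤) :
    Submodule.span ℂ (Set.range (U.quadU x)) = ⊤ := by
  have h1 := U.span_uvec_eq_top M x hsp
  have hq : ∀ a b c d : U.CohC (U.prod4 K Φ) 1, U.quadC _ a b c d ∈ Submodule.span ℂ (Set.range (U.quadU x)) := by
    intro a b c d
    refine quadC_mem_span _ (U.uvec x) _ (fun p => Submodule.subset_span (Set.mem_range.mpr ⟨p, rfl⟩))
      ?_ ?_ ?_ ?_ <;> simp [h1]
  have key : ∀ w : U.Coh (U.prod4 K Φ) 4, ((1 : ℂ) ⊗ₜ[ℚ] w : U.CohC _ 4) ∈ Submodule.span ℂ (Set.range (U.quadU x)) := by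
    intro w
    have hw : w ∈ Submodule.span ℚ {x | ∃ a b c d : U.Coh (U.prod4 K Φ) 1,
        x = U.cup _ 2 2 (U.cup _ 1 1 a b) (U.cup _ 1 1 c d)} := by rw [M.H4_span K Φ]; trivial
    induction hw using Submodule.span_induction with
    | mem w hw =>
      obtain ⟨a, b, c, d, rfl⟩ := hw
      have : ((1 : ℂ) ⊗ₜ[ℚ] U.cup _ 2 2 (U.cup _ 1 1 a b) (U.cup _ 1 1 c d) : U.CohC (U.prod4 K Φ) 4) =
          U.quadC _ ((1 : ℂ) ⊗ₜ a) ((1 : ℂ) ⊗ₜ b) ((1 : ℂ) ⊗ₜ c) ((1 : ℂ) ⊗ₜ d) := by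
        simp only [Universe.quadC, cup2C_tmul, mul_one]
      rw [this]; exact hq _ _ _ _
    | zero => simp
    | add w w' _ _ h h' => simpa only [TensorProduct.tmul_add] using add_mem h h'
    | smul r w _ h =>
      rw [TensorProduct.tmul_smul, ← algebraMap_smul ℂ r]
      exact Submodule.smul_mem _ _ h
  rw [eq_top_iff]
  rintro t -
  induction t using TensorProduct.induction_on with
  | zero => exact zero_mem _
  | add t t' h h' => exact add_mem h h'
  | tmul c w =>
    have : c ⊗ₜ[ℚ] w = c • ((1 : ℂ) ⊗ₜ[ℚ] w) := by rw [TensorProduct.smul_tmul', smul_eq_mul, mul_one]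
    rw [this]
    exact Submodule.smul_mem _ c (key w)

/-- The `Q_p` are eigenvectors of the diagonal action of `a`, eigenvalue `∏ⱼ τ_{pⱼ}(a)`. -/
theorem pullC_quadU (M : U.ModelAxioms) {a : K} {Ma : U.Mor (U.prod4 K Φ) (U.prod4 K Φ)}
    (h : U.IsDiagAct K Φ a Ma) (x : (i : Fin 4) → (K →+* ℂ) → U.CohC (U.cmAV K (Φ i)) 1)
    (hx : ∀ i τ, x i τ ∈ U.eigenLine K (Φ i) τ) (p : Fin 4 → Lab K) :
    U.pullC Ma 4 (U.quadU x p) = (∏ j, (p j).2 a) • U.quadU x p := by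
  obtain ⟨e, he, hcomm⟩ := h
  have key : ∀ q : Lab K, U.pullC Ma 1 (U.uvec x q) = q.2 a • U.uvec x q := by
    rintro ⟨i, τ⟩
    simp only [Universe.uvec]
    have h2 := congrArg (LinearMap.baseChange ℂ) (hcomm i 1)
    rw [LinearMap.baseChange_comp, LinearMap.baseChange_comp, he i] at h2
    have h3 := LinearMap.congr_fun h2 (x i τ)
    simp only [LinearMap.comp_apply] at h3
    change U.pullC Ma 1 (U.pullC (U.pr4 K Φ i) 1 (x i τ)) = _
    rw [show U.pullC Ma 1 (U.pullC (U.pr4 K Φ i) 1 (x i τ)) =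
      U.pullC (U.pr4 K Φ i) 1 ((((U.cmAct K (Φ i)).ι a).baseChange ℂ) (x i τ)) from h3,
      (mem_eigenLine_iff.mp (hx i τ)) a, map_smul]
  simp only [Universe.quadU, pullC_quadC M.pull_cup, key, quadC_smul, Fin.prod_univ_four]

/-! ### S4. The `σ⁴`-part is the Weil line through `y_σ` (alternation) -/

/-- A four-fold cup of classes in the span of the `τ`-eigenvectors of the four corners lies in the span of the Weil generator at `τ`. -/
theorem quadC_mem_span_weilGen (M : U.ModelAxioms) (x : (i : Fin 4) → (K →+* ℂ) → U.CohC (U.cmAV K (Φ i)) 1)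
    (τ : K →+* ℂ) (v : Fin 4 → U.CohC (U.prod4 K Φ) 1)
    (hv : ∀ j, v j ∈ Submodule.span ℂ (Set.range fun i : Fin 4 => U.uvec x (i, τ))) :
    U.quadC _ (v 0) (v 1) (v 2) (v 3) ∈ ℂ ∙ U.weilGen K Φ (fun i => x i τ) :=
  quadC_mem_span _ (fun i : Fin 4 => U.uvec x (i, τ)) _
    (fun p => quadC_comp_mem_span_singleton M.cup_comm1 M.cup_interchange _ (fun i : Fin 4 => U.uvec x (i, τ)) p)
    (hv 0) (hv 1) (hv 2) (hv 3)

end prod4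

end Universe

end Summit.HodgeConjecture.CorCM

end
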